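import Literature.Barriers.QuantumAdvantage.FortnowRogersOracle
import Literature.Barriers.QuantumAdvantage.CohenGenericJoinPneNP
import Literature.Barriers.QuantumAdvantage.AaronsonChenPHWindow
import Literature.Barriers.QuantumAdvantage.AaronsonChenPH
import Literature.Computability.Complexity.RandomOraclePHProofs
import Literature.Computability.Complexity.RandomOraclePHSipserProofs
import Literature.Computability.Complexity.AverageCaseDepthHierarchyThm1
import Literature.Computability.Complexity.OracleCompositionMachine
import HarnessLib

/-!
# The polynomial-time hierarchy is infinite relative to `B ⊕ G` for every Cohen generic `G` (discharge of `isInfinitePHRel_join_generic`)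

Proof file (D-0014: theorems and concrete definitions only) for the named fact
`Literature.Barriers.QuantumAdvantage.isInfinitePHRel_join_generic` of `FortnowRogersOracle.lean`
— the "hierarchy" half of the oracle of Fortnow–Rogers 1999, Cor. 3.7 (arXiv:cs/9811023, §3
p. 5: "We can create an oracle `H` by starting with an oracle making `P = PSPACE` and joining a
generic `G` to that. Because the polynomial-time hierarchy is infinite relative to generic
oracles …") and of Fenner–Fortnow–Kurtz–Li 2003, §1 p. 3 ("Yao's construction of an oracle
that separates the polynomial hierarchy works by finite extension, and so any Cohen generic
oracle must also separate the polynomial hierarchy"), typed in the tree as: for every base oracle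
`B` there is a countable family `𝒮` of sets of Cohen conditions such that `Σₖ^{B ⊕ G} ≠ Σₖ₊₁^{B ⊕ G}`
for all `k` and every `𝒮`-generic `G`. Its level `k = 0` was proved in
`CohenGenericJoinPneNP.lean` (Baker–Gill–Solovay requirements); this file proves ALL levels:

* **the finite-extension step** (`GenPH.isDense_forces_req`): for every description `Dsc` of a
  `Σₖ^{B ⊕ ·}` predicate (`PHDescr`, `k` quantifier bounds, ANY base oracle `B` hard-wired) the
  conditions forcing "`Dsc^{B ⊕ G}` differs from the Sipser language `sipserLang (k+3) G`
  somewhere" are DENSE. Given a condition `τ`, take an RST parameter `m` beyond the lengths in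
  `dom τ` and beyond the threshold of the circuit lower bound; at the input `x = sipserInput m (k+3)`
  the predicate is an `acBasis` circuit of `acDepth ≤ k + 2` and size `2^{poly(|x|)} = 2^{polylog n}`
  in the oracle bits of the `n = rstN m (k+3)` leaf strings (the tree's PROVED
  `fSS84_phWindowCircuits_holds`, through the join: `GenPH.exists_leafCircuit`), for every
  setting of the other strings; by the depth hierarchy theorem for the Sipser functions — here
  the tree's PROVED average-case form, Rossman–Servedio–Tan 2015 Thm. 1
  (`rossmanServedioTan2015_thm1_inRegime_holds` via `rst_thm1_regime_of_inRegime`: agreement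
  on at most `3/5 < 1` of the leaf settings), which a fortiori gives ONE leaf setting `u` on
  which the circuit errs (`GenPH.exists_badLeaves`; Yao 1985 / Håstad 1986 prove exactly this
  worst-case statement) — patch an oracle extending `τ` by `u` on the leaves and restrict it to
  all strings up to the reach of the predicate: the resulting condition extends `τ` and forces
  the disagreement at `x` (locality of `Dsc.lang` and of `sipserLang`);
* **genericity** (`GenPH.phDiagFamily`, countable by `exists_enum_PHDescr
  countable_polyTimeOracleAlg_holds`; `IsGeneric.of_forces_of_mem`): for a generic `G` every
  `Σₖ^{B ⊕ G}` language (`exists_levelLang_of_mem_sigmaPRel`) differs from `sipserLang (k+3) G`,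
  which lies in `PH^G ⊆ PH^{B ⊕ G}` (`sipserLang_mem_PHRel_holds`; `G ≤ᵀₚ B ⊕ G`,
  `PHRel_subset_PHRel_join`); so every level misses a `PH^{B ⊕ G}` language and no two
  consecutive levels coincide (`isInfinitePHRel_of_forall_exists`):
  `isInfinitePHRel_join_of_isGeneric`, whence **`isInfinitePHRel_join_generic_holds`** and the
  density of such `G` through every condition (`exists_extendedBy_isInfinitePHRel_join`).

With this, Fortnow–Rogers' Cor. 3.7 (`fortnowRogers1999_cor37`) rests on the single remaining
leaf `fennerFortnowKurtzLi2003_thm618_awpp` (Fenner–Fortnow–Kurtz–Li Thm. 6.18 (2)); see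
`SupremacyTheoremsNonRelativizingAssembly.lean`.

## References

* [FortnowRogers1999JCSS] arXiv:cs/9811023, §2.6 (generic oracles, requirements met by finite
  extension) and §3, proof of Cor. 3.7 (p. 5), read via `lit read arxiv:cs/9811023`.
* [FennerFortnowKurtzLi2003IC] doi:10.1016/s0890-5401(03)00018-x, §1 p. 3, §3.2 p. 14
  (genericity relative to `B`), Lemma 3.12 (existence of generics).
* [Ko1989] K.-I Ko, *Constructing oracles by lower bound techniques for circuits*, §2 (Lemmas
  2.1, 2.3: the `PH ↦ AC⁰` conversion) and §4.2 (the Sipser-type oracle languages `L_A`; "by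
  the lower bound … we can find an extension").
* [RossmanServedioTan2015] arXiv:1504.03398, Thm. 1 (p. 3) and §2.2 (p. 6: Håstad 1986 answers
  Meyer's question — some oracle makes `PH` infinite — by the worst-case depth hierarchy theorem).
-/

noncomputable section

namespace Literature.Barriers.QuantumAdvantage

open _root_.Computability Literature.Computability.Complexity Literature.Computability.Complexity.Classes
  Literature.Computability.Complexity.CohenCondition Literature.Computability.QuantumComplexity Finset

/-! ### `PH^G ⊆ PH^{B ⊕ G}` -/

/-- `P^G ⊆ P^{B ⊕ G}`: `G ∈ P^{B ⊕ G}` (`self_mem_PRel_join`, queries `w ↦ 1w`) and polynomial-time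
oracle machines compose (`OracleAlg.PRel_subset_PRel_of_mem_FPRel`).
[cite: FennerFortnowKurtzLi2003IC, §3.2 p. 14] -/
theorem PRel_subset_PRel_join (B G : Language Bool) :
    PRel (Oracle.ofLanguage G) ⊆ PRel (Oracle.ofLanguage (oracleJoin B G)) :=
  OracleAlg.PRel_subset_PRel_of_mem_FPRel
    (OracleAlg.ofLanguage_mem_FPRel_of_mem_PRel (self_mem_PRel_join B G))

/-- `Σₖ^G ⊆ Σₖ^{B ⊕ G}` (the iterated operator `Σₖ₊₁ = ∃ᵖ·coΣₖ` is monotone in the base class).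
[cite: FennerFortnowKurtzLi2003IC, §3.2 p. 14] -/
theorem SigmaPRel_subset_SigmaPRel_join (B G : Language Bool) (k : ℕ) :
    SigmaPRel (Oracle.ofLanguage G) k ⊆ SigmaPRel (Oracle.ofLanguage (oracleJoin B G)) k :=
  sigmaP_mono (PRel_subset_PRel_join B G) k

/-- `PH^G ⊆ PH^{B ⊕ G}`. [cite: FennerFortnowKurtzLi2003IC, §3.2 p. 14] -/
theorem PHRel_subset_PHRel_join (B G : Language Bool) :
    PHRel (Oracle.ofLanguage G) ⊆ PHRel (Oracle.ofLanguage (oracleJoin B G)) :=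
  Set.iUnion_mono fun k => SigmaPRel_subset_SigmaPRel_join B G k

namespace GenPH

/-! ### The requirements -/

/-- Joins `B ⊕ O`, `B ⊕ O'` agree on the strings of length `≤ R` as soon as `O`, `O'` agree on
the strings `t` with `|t| + 1 ≤ R` (the query `1t` reads `t`). [cite: AaronsonChen2017, §5 (p. 20, O₀ ⊕ O₁)] -/
theorem join_agree {B O O' : Language Bool} {R : ℕ}
    (h : ∀ t : List Bool, t.length + 1 ≤ R → (t ∈ O ↔ t ∈ O')) :
    ∀ s : List Bool, s.length ≤ R → (s ∈ oracleJoin B O ↔ s ∈ oracleJoin B O')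
  | [], _ => by simp
  | false :: t, _ => by simp
  | true :: t, hs => by
    rw [true_cons_mem_oracleJoin, true_cons_mem_oracleJoin]
    exact h t (by simpa using hs)

/-- **The requirement of a description** `Dsc` (with `k = |Dsc.bounds|` quantifier bounds and
the base oracle `B` hard-wired): the `Σₖ^{B ⊕ G}` predicate it describes differs from the Sipser
language `sipserLang (k+3) G` at some input ("`R_i`: the `i`-th `Σₖ` machine does not decide
`L_G`"). [cite: FortnowRogers1999JCSS, §2.6 (arXiv numbering)] [cite: Ko1989, §4.2 (p. 15)] -/
def Req (B : Language Bool) (Dsc : PHDescr) (G : Language Bool) : Prop :=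
  ∃ x : List Bool, ¬ (x ∈ Dsc.lang (oracleJoin B G) ↔ x ∈ sipserLang (Dsc.bounds.length + 3) G)

/-- The depth of the Sipser language used against level `k`: `d = k + 3`. [cite: RossmanServedioTan2015, §2.3 (p. 7)] -/
abbrev dp (k : ℕ) : ℕ := k + 3

/-- The RST input of parameter `m` used against level `k`. [cite: RossmanServedioTan2015, §6 (p. 15)] -/
abbrev inp (k m : ℕ) : List Bool := sipserInput m (dp k)

/-- The fan-ins of `Sipser_{k+3}` at parameter `m`. [cite: RossmanServedioTan2015, §6 (p. 15)] -/
abbrev fanins (k m : ℕ) : List ℕ := rstFanins m (dp k)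

/-- `d = k + 3 ≥ 2`. [folklore] -/
theorem two_le_dp (k : ℕ) : 2 ≤ dp k := by
  simp [dp]

/-- The `n` leaves fit below `2^{|x|}`. [folklore] -/
theorem fit (k m : ℕ) : (fanins k m).prod ≤ 2 ^ (inp k m).length :=
  (rstN_lt_two_pow_length_sipserInput m (dp k)).le

/-! ### The predicate at the RST input is a small-depth circuit in the leaf bits, through the join -/

/-- **The leaf circuit of a `PH` predicate through the join** (Furst–Saxe–Sipser / Ko Lemma 2.3,
the tree's `FSS84_phWindowCircuits`, over the leaf window of the Sipser instance at `x`): for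
every base oracle `B` and every setting `y` of the other strings there is an `acBasis` circuit of
`acDepth ≤ |bounds| + 2` and size `≤ 2^{S(|x|)}` whose value on a leaf setting `u` is
`[x ∈ Dsc.lang (B ⊕ (y patched by u on the leaves))]`. [cite: Ko1989, Lemmas 2.1 and 2.3] -/
theorem exists_leafCircuit (Dsc : PHDescr) {Sz : Polynomial ℕ}
    (hS : ∀ (x : List Bool) (W : ℕ) (e : Fin W → List Bool), Function.Injective e →
      ∀ A₀ : Language Bool, ∃ C : Circuit (Fin W), C.IsOver acBasis ∧
        C.acDepth ≤ Dsc.bounds.length + 2 ∧ C.size ≤ 2 ^ Sz.eval x.length ∧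
        ∀ w : Fin W → Bool, C.eval w = (Dsc.lang (patchLang A₀ e w)).boolIndicator x)
    (x : List Bool) {ws : List ℕ} (hfit : ws.prod ≤ 2 ^ x.length) (B y : Language Bool) :
    ∃ C : Circuit (Addr ws), C.IsOver acBasis ∧ C.acDepth ≤ Dsc.bounds.length + 2 ∧
      C.size ≤ 2 ^ Sz.eval x.length ∧
      ∀ u : Addr ws → Bool,
        (C.eval u = true ↔ x ∈ Dsc.lang (oracleJoin B (patchLang y (sipserLeaf x ws) u))) := by
  classical
  let τ : Addr ws ≃ Fin (Fintype.card (Addr ws)) := Fintype.equivFin _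
  have heinj : Function.Injective (fun i : Fin (Fintype.card (Addr ws)) =>
      true :: sipserLeaf x ws (τ.symm i)) := fun i j hij =>
    τ.symm.injective (sipserLeaf_injective hfit (List.cons_eq_cons.1 hij).2)
  obtain ⟨C, hB, hd, hs, hev⟩ := hS x _ _ heinj (oracleJoin B y)
  refine ⟨C.mapInputs τ.symm, hB.mapInputs _, by simpa using hd, by simpa using hs, fun u => ?_⟩
  have hpatch : patchLang (oracleJoin B y) (fun i => true :: sipserLeaf x ws (τ.symm i))
      (fun i => u (τ.symm i)) = oracleJoin B (patchLang y (sipserLeaf x ws) u) := by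
    rw [patchLang_oracleJoin B y (fun i => sipserLeaf x ws (τ.symm i)) (fun i => u (τ.symm i))]
    exact congrArg (oracleJoin B)
      (_root_.Literature.Barriers.QuantumAdvantage.patchLang_comp_equiv y (sipserLeaf x ws) u τ.symm)
  rw [Circuit.eval_mapInputs, hev, hpatch]
  exact (Set.mem_iff_boolIndicator _ _).symm

/-- **Some leaf setting defeats the predicate** (the circuit lower bound as used in a
finite-extension argument, Ko §4.2: "we can find an extension … such that `C` does not compute
`f`"): for a description with `k` quantifier bounds, for all large `m`, every base oracle `B` and
every setting `y` of the non-leaf strings, some setting `u` of the `n` leaves of the RST input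
`x = sipserInput m (k+3)` makes `[x ∈ Dsc.lang (B ⊕ (y patched by u))] ≠ Sipser_{k+3}(u)` — the leaf
circuit has `acDepth ≤ k + 2` and size `2^{polylog n}`, and by RST Thm. 1 it agrees with
`Sipser_{k+3}` on at most `3/5` of the `2ⁿ` leaf settings. [cite: Ko1989, §4.2 (p. 15–16)] [cite: RossmanServedioTan2015, Thm. 1 (p. 3) and §2.2 (p. 6)] -/
theorem exists_badLeaves (k : ℕ) (B : Language Bool) (Dsc : PHDescr) (hk : Dsc.bounds.length = k) :
    ∃ m₁ : ℕ, ∀ m : ℕ, m₁ ≤ m → ∀ y : Language Bool, ∃ u : Addr (fanins k m) → Bool,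
      ¬ ((inp k m ∈ Dsc.lang (oracleJoin B (patchLang y (sipserLeaf (inp k m) (fanins k m)) u))) ↔
          balancedSipser m (dp k) u = true) := by
  classical
  obtain ⟨Sz, hSz⟩ := fSS84_phWindowCircuits_holds Dsc
  obtain ⟨c₂, kk, hck⟩ := exists_eval_le_mul_pow_add Sz
  obtain ⟨m₁, hm₁⟩ := rst_thm1_regime_of_inRegime rossmanServedioTan2015_thm1_inRegime_holds
    rossmanServedioTan2015_w0_asymp_holds (two_le_dp k) c₂ kk 6 (12 * dp k + 9)
  refine ⟨m₁, fun m hm y => ?_⟩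
  obtain ⟨⟨hm1, hW, hW0, hlog⟩, hthm⟩ := hm₁ m hm
  obtain ⟨C, hCB, hCd, hCs, hCev⟩ := exists_leafCircuit Dsc hSz (inp k m) (fit k m) B y
  have hlen : (inp k m).length ≤ 6 * Nat.log 2 (rstN m (dp k)) + (12 * dp k + 9) :=
    length_sipserInput_le (two_le_dp k) hm1 hW hW0 hlog
  have hs' : C.size ≤ 2 ^ (c₂ * (6 * Nat.log 2 (rstN m (dp k)) + (12 * dp k + 9)) ^ kk + c₂) := by
    refine hCs.trans (Nat.pow_le_pow_right (by norm_num) ?_)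
    exact (TM2Iter.eval_mono Sz hlen).trans (hck _)
  have hd' : C.acDepth ≤ dp k - 1 := by
    rw [hk] at hCd
    exact hCd.trans (by simp [dp])
  have hcard := hthm C hCB hd' hs'
  -- not every leaf setting is an agreement
  by_contra hall
  simp only [not_exists, not_not] at hall
  have hfilter : ((univ : Finset (Addr (fanins k m) → Bool)).filter
      fun u => C.eval u = balancedSipser m (dp k) u) = univ := by
    refine Finset.filter_true_of_mem fun u _ => ?_
    rw [Bool.eq_iff_iff, hCev u]
    exact hall u
  rw [hfilter, card_univ, Fintype.card_fun, Fintype.card_bool, Addr.card] at hcard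
  have h2 : (0 : ℝ) < 2 ^ (fanins k m).prod := by positivity
  have : ((2 ^ (fanins k m).prod : ℕ) : ℝ) = 2 ^ rstN m (dp k) := by push_cast; rfl
  rw [this] at hcard
  have h2' : (0 : ℝ) < 2 ^ rstN m (dp k) := by positivity
  linarith

/-! ### Density of the forcing conditions -/

/-- The lengths of the strings decided by a condition are bounded (finite domain). [folklore] -/
theorem exists_length_lt (τ : CohenCondition) : ∃ L : ℕ, ∀ q ∈ τ.dom, q.length < L := by
  obtain ⟨L, hL⟩ := (τ.dom_finite.image List.length).bddAbove
  exact ⟨L + 1, fun q hq => Nat.lt_succ_of_le (hL ⟨q, hq, rfl⟩)⟩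

/-- **The forcing condition** built from a bad leaf setting: with `x = sipserInput m (k+3)`, an
oracle `y` extending `τ` whose decided strings are shorter than `L ≤ m`, and a leaf setting `u`
on which the predicate (for the rest `y`) disagrees with `Sipser_{k+3}`, the restriction of
`G₀ = y` patched by `u` on the leaves to `dom τ` and all strings up to the reach at `x` extends
`τ` and forces the requirement (both sides read `G` only below that reach; the leaf strings,
of length `2|x| ≥ 2m`, avoid `dom τ`). [cite: Ko1989, §4.2 (p. 15–16)] [cite: FortnowRogers1999JCSS, §2.6 (arXiv numbering)] -/
theorem exists_forces_req_ge (B : Language Bool) (Dsc : PHDescr) {k : ℕ} (hk : Dsc.bounds.length = k)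
    (τ : CohenCondition) {L m : ℕ} (hL : ∀ q ∈ τ.dom, q.length < L) (hLm : L ≤ m)
    {y : Language Bool} (hy : τ.ExtendedBy y) {u : Addr (fanins k m) → Bool}
    (hu : ¬ ((inp k m ∈ Dsc.lang (oracleJoin B
        (patchLang y (sipserLeaf (inp k m) (fanins k m)) u))) ↔ balancedSipser m (dp k) u = true)) :
    ∃ σ ∈ {σ : CohenCondition | σ.Forces (Req B Dsc)}, τ ≤ σ := by
  classical
  have hLx : L ≤ (inp k m).length := hLm.trans (le_length_sipserInput m (dp k))
  -- `G₀ := y` patched by `u` on the leaves extends `τ`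
  have hleaf : ∀ (a : Addr (fanins k m)) (q : List Bool), q ∈ τ.dom →
      sipserLeaf (inp k m) (fanins k m) a ≠ q := by
    intro a q hq h
    have h1 := hL q hq
    have h2 : (sipserLeaf (inp k m) (fanins k m) a).length = 2 * (inp k m).length :=
      length_sipserAddr (inp k m) _
    rw [h] at h2
    omega
  have hG₀τ : τ.ExtendedBy (patchLang y (sipserLeaf (inp k m) (fanins k m)) u) := by
    intro q b hq
    have hqdom : q ∈ τ.dom := by
      rw [mem_dom_iff, hq]
      exact Option.some_ne_none b
    rw [mem_patchLang_of_not_mem_range u fun a => hleaf a q hqdom]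
    exact hy q b hq
  -- freeze `dom τ` and everything up to the reach at `x`
  refine ⟨restrict (patchLang y (sipserLeaf (inp k m) (fanins k m)) u)
      (τ.dom_finite.toFinset ∪ (List.finite_length_le Bool
        (max (Dsc.reach (inp k m).length) (2 * (inp k m).length))).toFinset), ?_,
    le_restrict_of_extendedBy hG₀τ fun q hq => ?_⟩
  · -- the restriction forces the requirement, witnessed by `x`
    intro G hG
    refine ⟨inp k m, fun hiff => hu ?_⟩
    have hagree : ∀ q : List Bool, q.length ≤ max (Dsc.reach (inp k m).length) (2 * (inp k m).length) →
        (q ∈ G ↔ q ∈ patchLang y (sipserLeaf (inp k m) (fanins k m)) u) := by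
      intro q hq
      refine hG.mem_iff_mem (extendedBy_restrict _ _) ?_
      rw [dom_restrict]
      simp only [Finset.coe_union, Set.Finite.coe_toFinset, Set.mem_union, Set.mem_setOf_eq]
      exact Or.inr hq
    have hr1 := le_max_left (Dsc.reach (inp k m).length) (2 * (inp k m).length)
    have hr2 := le_max_right (Dsc.reach (inp k m).length) (2 * (inp k m).length)
    have h1 : inp k m ∈ Dsc.lang (oracleJoin B G) ↔
        inp k m ∈ Dsc.lang (oracleJoin B (patchLang y (sipserLeaf (inp k m) (fanins k m)) u)) :=
      Dsc.lang_congr (inp k m) (join_agree fun t ht => hagree t (by omega))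
    have h2 : inp k m ∈ sipserLang (Dsc.bounds.length + 3) G ↔
        inp k m ∈ sipserLang (dp k) (patchLang y (sipserLeaf (inp k m) (fanins k m)) u) := by
      rw [hk]
      exact sipserLang_congr fun q hq => hagree q (by omega)
    have h3 : inp k m ∈ sipserLang (dp k) (patchLang y (sipserLeaf (inp k m) (fanins k m)) u) ↔
        balancedSipser m (dp k) u = true := by
      rw [sipserInput_mem_iff (two_le_dp k)]
      have hbits : (fun a => (patchLang y (sipserLeaf (inp k m) (fanins k m)) u).boolIndicator
          (sipserLeaf (sipserInput m (dp k)) (rstFanins m (dp k)) a)) = u := by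
        funext a
        rw [Bool.eq_iff_iff, ← Set.mem_iff_boolIndicator]
        exact mem_patchLang_of_eq (sipserLeaf_injective (fit k m)) u a
      rw [hbits]
    exact h1.symm.trans (hiff.trans (h2.trans h3))
  · -- `dom τ ⊆ s`
    simp only [Finset.coe_union, Set.Finite.coe_toFinset, Set.mem_union]
    exact Or.inl hq

/-- **The finite-extension step: the conditions forcing the requirement of a description are
dense** (for EVERY base oracle `B` and every description, computable or not): given `τ`, choose
an RST parameter `m` beyond the lengths in `dom τ` and the threshold of `exists_badLeaves`, an
oracle `y` extending `τ`, and a bad leaf setting `u` for the rest `y`; then `exists_forces_req_ge`.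
[cite: Ko1989, §4.2 (p. 15–16)] [cite: FortnowRogers1999JCSS, §2.6 (arXiv numbering)] [cite: FennerFortnowKurtzLi2003IC, §1 p. 3] -/
theorem isDense_forces_req (B : Language Bool) (Dsc : PHDescr) :
    IsDense {σ : CohenCondition | σ.Forces (Req B Dsc)} := by
  rw [isDense_iff]
  intro τ
  obtain ⟨m₁, hm₁⟩ := exists_badLeaves Dsc.bounds.length B Dsc rfl
  obtain ⟨L, hL⟩ := exists_length_lt τ
  obtain ⟨y, hy, -⟩ := exists_extendedBy_isGeneric (𝒮 := (∅ : Set (Set CohenCondition)))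
    Set.countable_empty τ
  obtain ⟨u, hu⟩ := hm₁ (max m₁ L) (le_max_left _ _) y
  exact exists_forces_req_ge B Dsc rfl τ hL (le_max_right _ _) hy hu

/-! ### The family of requirements and the generic separation -/

/-- The family of forcing sets of the requirements, over all descriptions with a polynomial-time
innermost machine (the base oracle `B` hard-wired). [cite: FortnowRogers1999JCSS, §2.6 (arXiv numbering)] -/
def phDiagFamily (B : Language Bool) : Set (Set CohenCondition) :=
  (fun Dsc : PHDescr => {σ : CohenCondition | σ.Forces (Req B Dsc)}) ''
    {D : PHDescr | D.M.IsPolyTime encodingBoolBool}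

/-- The family is countable (countably many polynomial-time machines, `countable_polyTimeOracleAlg_holds`).
[cite: AroraBarakCC2009, §1.4] -/
theorem phDiagFamily_countable (B : Language Bool) : (phDiagFamily B).Countable := by
  obtain ⟨e, he⟩ := exists_enum_PHDescr countable_polyTimeOracleAlg_holds
  exact ((Set.countable_range e).mono he).image _

/-- Every member of the family is dense. [cite: Ko1989, §4.2] -/
theorem isDense_of_mem_phDiagFamily {B : Language Bool} {S : Set CohenCondition}
    (hS : S ∈ phDiagFamily B) : IsDense S := by
  obtain ⟨Dsc, -, rfl⟩ := hS
  exact isDense_forces_req B Dsc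

/-- **For a generic `G`, the Sipser language of depth `k + 3` escapes `Σₖ^{B ⊕ G}`**: every
`Σₖ^{B ⊕ G}` language has a description with `k` bounds (`exists_levelLang_of_mem_sigmaPRel`),
whose requirement `G` satisfies by genericity. [cite: FortnowRogers1999JCSS, §2.6 and §3 (arXiv numbering)] [cite: Ko1989, §4.2] -/
theorem sipserLang_not_mem_sigmaPRel_join_of_isGeneric {B G : Language Bool}
    (hG : IsGeneric (phDiagFamily B) G) (k : ℕ) :
    sipserLang (k + 3) G ∉ SigmaPRel (Oracle.ofLanguage (oracleJoin B G)) k := by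
  intro hmem
  obtain ⟨ps, M, q, hM, hlen, hL⟩ := exists_levelLang_of_mem_sigmaPRel hmem
  have hR : Req B ⟨ps, M, q⟩ G :=
    hG.of_forces_of_mem ⟨⟨ps, M, q⟩, hM, rfl⟩ (isDense_forces_req B _) fun _ h => h
  obtain ⟨x, hx⟩ := hR
  apply hx
  change x ∈ levelLang M q (oracleJoin B G) ps ↔ x ∈ sipserLang (ps.length + 3) G
  rw [← hL, hlen]

end GenPH

/-- **`PH^{B ⊕ G}` is infinite for every `phDiagFamily B`-generic `G`**: each level `Σₖ^{B ⊕ G}`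
misses the `PH^G ⊆ PH^{B ⊕ G}` language `sipserLang (k+3) G` (`sipserLang_mem_PHRel_holds`), so
no two consecutive levels coincide. [cite: FortnowRogers1999JCSS, §3, proof of Cor. 3.7 (arXiv numbering)] [cite: FennerFortnowKurtzLi2003IC, §1 p. 3] -/
theorem isInfinitePHRel_join_of_isGeneric {B G : Language Bool} (hG : IsGeneric (GenPH.phDiagFamily B) G) :
    IsInfinitePHRel (Oracle.ofLanguage (oracleJoin B G)) :=
  isInfinitePHRel_of_forall_exists fun k =>
    ⟨sipserLang (k + 3) G, PHRel_subset_PHRel_join B G (sipserLang_mem_PHRel_holds (k + 3) G),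
      GenPH.sipserLang_not_mem_sigmaPRel_join_of_isGeneric hG k⟩

/-- **Discharge of `isInfinitePHRel_join_generic`** ("the polynomial-time hierarchy is infinite
relative to generic oracles", joined with an arbitrary base oracle `B`): for every `B` the
countable family `GenPH.phDiagFamily B` of sets of Cohen conditions has `Σₖ^{B ⊕ G} ≠ Σₖ₊₁^{B ⊕ G}`
for all `k` and every generic `G` — by finite extension (Furst–Saxe–Sipser circuits of the
predicates, the depth hierarchy theorem for the Sipser functions in the tree's proved form RST
Thm. 1, locality) and the genericity lemma. [cite: FortnowRogers1999JCSS, §3, proof of Cor. 3.7 (arXiv numbering)] [cite: FennerFortnowKurtzLi2003IC, §1 p. 3 and §3.2 p. 14] -/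
theorem isInfinitePHRel_join_generic_holds : isInfinitePHRel_join_generic := fun B =>
  ⟨GenPH.phDiagFamily B, GenPH.phDiagFamily_countable B, fun _ hG => isInfinitePHRel_join_of_isGeneric hG⟩

/-- Such `G` exist through every condition, for every `B` (existence of generics for countable
families, Fenner–Fortnow–Kurtz–Li Lemma 3.12). [cite: FennerFortnowKurtzLi2003IC, Lemma 3.12 (p. 11)] -/
theorem exists_extendedBy_isInfinitePHRel_join (B : Language Bool) (σ₀ : CohenCondition) :
    ∃ G : Language Bool, σ₀.ExtendedBy G ∧ IsInfinitePHRel (Oracle.ofLanguage (oracleJoin B G)) := by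
  obtain ⟨G, hσ₀, hG⟩ := exists_extendedBy_isGeneric (GenPH.phDiagFamily_countable B) σ₀
  exact ⟨G, hσ₀, isInfinitePHRel_join_of_isGeneric hG⟩

/-- **The oracle-existence step of Cor. 3.7 down to Thm. 6.18 (2)**: granted
`fennerFortnowKurtzLi2003_thm618_awpp`, there is an oracle `A = B ⊕ G` (`B` `PSPACE`-complete,
`exists_isComplete_PSPACE` given) with `P^A = AWPP^A` and `PH^A` infinite. [cite: FortnowRogers1999JCSS, §3, proof of Cor. 3.7 (arXiv numbering)] [cite: FennerFortnowKurtzLi2003IC, Thm. 6.18 (2) and pp. 33–34] -/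
theorem exists_oracle_PRel_eq_AWPPRel_infinitePH_of_thm618 (h₁ : fennerFortnowKurtzLi2003_thm618_awpp)
    (h₃ : exists_isComplete_PSPACE) :
    ∃ A : Language Bool, PRel (Oracle.ofLanguage A) = AWPPRel (Oracle.ofLanguage A) ∧
      IsInfinitePHRel (Oracle.ofLanguage A) :=
  exists_oracle_PRel_eq_AWPPRel_infinitePH_of_generic h₁ isInfinitePHRel_join_generic_holds h₃

end Literature.Barriers.QuantumAdvantage

end
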